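import Mathlib
import HarnessLib
import HarnessLib.Audit
import Summits.AnomalousDissipation.Statement
import Literature.Analysis.FluidPDE.StokesTorus
import Summits.AnomalousDissipation.AnomalousDissipation.Theorems.SteadyWeakLimitSteadyToSummit
import HarnessLib.Audit.Status.Attr

/-!
Route: LambCircleTG

# Route LambCircleTG — Steady zeroth law for the Taylor–Green pattern force, won against its
explicit one-mode Euler dodgers (Lamb circle)

It suffices to show X = SteadyLoudTG: for the explicit Taylor–Green PATTERN force f♯ := Λ(U) =
P(U·∇U) of the Taylor–Green
vortex U — on the unit torus f♯ = (π/8)·Σ_{k ∈ (2,0,±2),(0,2,±2)} sin(2πk·X) a_k with a_k ⊥ k (four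
Stokes modes on the shell
|k|² = 8; = 2π·F_TG(2πX) for the card's F_TG = ⅛(sin2x cos2z, sin2y cos2z, −sin2z(cos2x+cos2y))) —
there are ν_j → 0⁺ and
MEAN-ZERO steady classical Navier–Stokes states (u_j, p_j) on T³ forced by f♯ with sup_j ∫|u_j|² < ∞
and ν_j‖∇u_j‖² ≥ ε > 0.
This realises card lamb-syzygy-taylor-green-circle in its minimal arena: the Lamb map winds
Brachet's circle of Taylor–Green
vortices twice (Λ(U_θ) = cos2θ·F_TG + sin2θ·G_TG), so f♯ AND −f♯ are held still by explicit one-mode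
work-free steady Euler
states — for f♯: U = ¼Σ_{k∈(1,±1,±1)} sin(2πk·X) b_k (the TG vortex) and the conjugate vortex W =
τ_*U_{π/2} (kit j001623:
Λ(U) = Λ(W) = f♯ exactly). X is split into a bounded mean-zero steady branch (BoundedSteadyBranchTG)
and a Liouville-type
statement that no bounded steady branch goes work-free (NoQuietSteadyTG), whose cheapest instances
are the two shadow cruxes.
Lean: `∃ (ν : ℕ → ℝ) (u : ℕ → UnitAddTorus (Fin 3) → EuclideanSpace ℝ (Fin 3)) (p : ℕ → UnitAddTorus
(Fin 3) → ℝ), (∀ j, 0 < ν j) ∧ Filter.Tendsto ν Filter.atTop (nhds 0) ∧ (∀ j,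
Literature.Analysis.FunctionSpaces.Torus.IsClassicalNSSolutionOn Set.univ (ν j) (fun _ => (fun x :
UnitAddTorus (Fin 3) => (Real.pi / 8 : ℝ) • (Literature.Analysis.FluidPDE.Torus.stokesMode ![2, 0,
2] !₂[1, 0, -1] false x + Literature.Analysis.FluidPDE.Torus.stokesMode ![2, 0, -2] !₂[1, 0, 1]
false x + Literature.Analysis.FluidPDE.Torus.stokesMode ![0, 2, 2] !₂[0, 1, -1] false x +
Literature.Analysis.FluidPDE.Torus.stokesMode ![0, 2, -2] !₂[0, 1, 1] false x))) (fun _ => u j) (fun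
_ => p j)) ∧ (∀ j, Literature.Analysis.FunctionSpaces.Torus.HasZeroMean (u j)) ∧ (∃ E : ℝ, ∀ j,
MeasureTheory.integral MeasureTheory.volume (fun x => ‖u j x‖ ^ 2) ≤ E) ∧ ∃ ε : ℝ, 0 < ε ∧ ∀ j, ε ≤
ν j * Literature.Analysis.FunctionSpaces.Torus.gradNormSq (u j)`

## Assembly
Pure logic, certified in glue.lean (theorem `closes`, rc 0 in Sketch.lean): BoundedSteadyBranchTG
gives (ν_j, u_j, p_j) mean-zero steady
states with ∫|u_j|² ≤ E; NoQuietSteadyTG applied to this very sequence gives ε > 0 with ε ≤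
ν_j‖∇u_j‖² for all j — this is SteadyLoudTG;
TGForceRegular supplies IsSmooth/IsDivFree/HasZeroMean of f♯, so the antecedent of SteadyToSummit
holds with f := f♯, and SteadyToSummit
returns AnomalousDissipation. The two shadow cruxes are special cases of NoQuietSteadyTG (modulo the
proved steady energy identity) and do
not enter the glue; TGDodgers documents why they are the relevant special cases.

Rationale: WHY THIS LINE. For steady states the budget is exact and linear, ν‖∇u‖² = (f,u)
(Torus.IsClassicalNSSolutionOn.energy_balance, proved in tree), so
the steady zeroth law at FIXED f is decided by whether L²-bounded steady branches can become
orthogonal to f as ν → 0, and their quiet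
endpoints are work-free steady Euler states Λ(V) = f ("dodgers") or singular relatives (sheets,
baths). The card computes the quadratic
Lamb map on the Taylor–Green family exactly (first harmonic of TaylorGreen1937
doi:10.1098/rspa.1937.0036; θ-circle and class K of
Brachet et al. doi:10.1017/s0022112083001159): the fibre over f♯ in the family is {±U} and, through
the quarter-shift τ with
τ_*F_TG = −F_TG, f♯ also has the conjugate dodgers ±W — four explicit one-mode competitors, each a
Stokes eigenfield (ΔU = −12π²U), so
"does the dodger have a steady viscous shadow" is at first order the LINEAR problem L_U w + ∇π = ΔU
for linearised steady Euler at a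
cellular flow (Newcomb-type streamline conditions; Khesin–Kuksin–Peralta-Salas, Adv. Math. 267
(2014)). Imported: real-algebraic
geometry of Λ (fibres/syzygies on finite families, S-lemma certificates; doi:10.1137/140957354 for
why rank-one questions live in
smooth classes) to enumerate competitors; steady-NS → steady-Euler selection theory
(Prandtl–Batchelor; rigidity arXiv:2601.08647,
layered existence arXiv:2111.03996) for the shadow cruxes; Leray–Schauder steady theory (Temam1979
Ch. II) for the branch. Versus prior
routes: CoherentStates 0219/0221 and SteadyWeakLimit 1303/1305 quantify ∃f abstractly; here f is
pinned to the one smooth 3-D force whose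
inviscid one-mode competitors are explicitly known, so "no quiet branch" becomes concrete forced,
periodic, three-dimensional
steady-selection problems plus a census, and a refutation is itself a first (a mean-zero witness of
SteadyBoundedBranch 0221, which the
negatives index shows drift cannot supply).

RANKED CRUXES. #0 SteadyLoudTG (target) — steady zeroth law for f♯: ν_j → 0⁺, mean-zero steady
classical NS states forced by f♯ with bounded ∫|u_j|² and ν_j‖∇u_j‖² ≥ ε > 0 (card K2, steady
sub-line; = CoherentStates.SteadyZerothLaw 0219 with f := f♯ and mean-zero states). (why it might
fail: Every bounded mean-zero steady branch of f♯ may be quiet (shadows of ±U, ±W; Prandtl–Batchelor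
sheets; Reynolds-stress baths), or none may be bounded (laminar scaling ∫|u|² ∼ ν⁻²); the 2-D
analogue is rigid (CTV2013 p.6).) [arXiv:1305.7089, arXiv:2311.04182, arXiv:2212.08413,
doi:10.1017/s0022112083001159]
#2 NoQuietSteadyTG (crux) — every sequence of MEAN-ZERO steady classical NS states forced by f♯ with
ν_j → 0⁺ and sup_j ∫|u_j|² < ∞ has inf_j ν_j‖∇u_j‖² > 0 (each term is positive and equals (f♯,u_j),
so this is liminf (f♯,u_j) > 0: no bounded steady branch of f♯ becomes work-free). Card K1/K3 made
load-bearing: its quiet endpoints would be dodgers Λ(V) = f♯ (±U, ±W at one mode) or their singular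
relatives. [difficulty: XL] (why it might fail: FALSE for the O(ν)-close forces f♯+12π²νU (U is then
an exact quiet bounded steady state ∀ν): only an argument exact in f can work. A steady shadow of
±U/±W (regular or √ν-layered), a sheeted PB state or a mean-flow-free Reynolds-stress bath refutes
it.) [arXiv:2601.08647, arXiv:2111.03996, doi:10.1137/140957354,
Literature.Barriers.AnomalousDissipation.DeRosaInversi2024_thm12, arXiv:1305.7089, arXiv:2212.08413]
#3 TGVortexNoShadow (crux) — no sequence of mean-zero steady classical NS states forced by f♯ with
ν_j → 0⁺ converges in L² to the Taylor–Green vortex U = ¼Σ_{k∈(1,±1,±1)} sin(2πk·X)b_k (the dodger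
Λ(U) = f♯ has no steady viscous shadow). Special case of NoQuietSteadyTG: such a sequence is bounded
and (f♯,u_j) → (f♯,U) = 0. Card K1 (θ = 0, planar closed cells). [deps: NoQuietSteadyTG]
[difficulty: L] (why it might fail: First-order solvability of L_U w + ∇π = ΔU on the planar TG
cells is undecided; cellular flows relax on the enhanced O(ν^-1/2) scale, so a Newton step of size
O(√ν) may close, or √ν layers along the cell separatrices may build a layered shadow as on the disk
(Fei–Gao–Lin–Tao).) [arXiv:2111.03996, arXiv:2601.08647, doi:10.1017/s0022112083001159,
KhesinKuksinPeraltaSalas2014 (Adv. Math. 267, 498–522), doi:10.1007/s11401-023-0011-3]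
#4 ConjugateVortexNoShadow (crux) — no sequence of mean-zero steady classical NS states forced by f♯
with ν_j → 0⁺ converges in L² to the conjugate vortex W = τ_*U_{π/2} = (1/(4√3))Σ_{k∈(1,±1,±1)}
sin(2πk·X)w_k (three-component; Λ(W) = f♯ because Λ(U_{π/2}) = −F_TG and τ_*F_TG = −F_TG, τ =
(¼,¼,0)). Special case of NoQuietSteadyTG. Card K1 (θ = π/2). [deps: NoQuietSteadyTG] [difficulty:
L] (why it might fail: W is genuinely three-component with non-integrable streamline geometry: no
Newcomb/streamline reduction of the linearised steady operator, so neither obstruction nor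
construction is cheap; a KAM-type or layered steady continuation (CDG-style flexibility) would
refute it.) [doi:10.1017/s0022112083001159, arXiv:2007.09103, arXiv:2205.01143, arXiv:2601.08647]
#5 BoundedSteadyBranchTG (crux) — there are ν_j → 0⁺ and mean-zero steady classical NS states
(u_j,p_j) forced by f♯ with sup_j ∫|u_j|² < ∞ (a bounded steady branch of the TG pattern force;
mean-zero steady states exist for every ν by Leray–Schauder, the content is the ν-uniform L² bound).
[difficulty: XL] (why it might fail: Only the laminar bound ‖∇u‖ ≤ ‖f‖/ν is known; every steady
branch of f♯ may inherit the Stokes scaling ∫|u|² ∼ ν⁻² (existence of bounded stationary sequences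
is open even for Kolmogorov forcing, CTV2013 p.3); if ±U, ±W have shadows it holds but crux 2 dies.)
[arXiv:1305.7089, Temam1979, FoiasManleyRosaTemam2001, doi:10.1088/0951-7715/28/9/3219]
#9 TGForceRegular (support) — f♯ is smooth, divergence-free and mean-zero (sum of four Stokes modes
sin(2πk·X)a_k with k ≠ 0 and k·a_k = 0: isSmooth_stokesMode, isDivFree_stokesMode,
hasZeroMean_stokesMode + linearity). [difficulty: provable-now]
[Literature.Analysis.FluidPDE.Torus.isSmooth_stokesMode,
Literature.Analysis.FluidPDE.Torus.isDivFree_stokesMode,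
Literature.Analysis.FluidPDE.Torus.hasZeroMean_stokesMode]
#9 TGDodgers (support) — the Taylor–Green vortex U and the conjugate vortex W are exact work-free
steady Euler states under f♯: (U·∇)U + ∇P = f♯ and (W·∇)W + ∇P′ = f♯ for smooth (trigonometric)
pressures (card P1 at θ = 0 and, via τ, θ = π/2; exact Fourier-coefficient checks kit j001623 and
j001650: both differences are gradients, (f♯,U) = (f♯,W) = 0, ∫|U|² = ∫|W|² = ¼, ∫|f♯|² = π²/16).
Provable by finite trigonometric algebra on products of Stokes modes. [difficulty: provable-now]
[doi:10.1098/rspa.1937.0036, doi:10.1017/s0022112083001159, kit:j001623]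
#9 TGLambCircle (support) — the card's Lamb-circle identity in unit-torus form: for every θ the
Taylor–Green field U_θ = (1/(2√3))Σ_{k∈(1,±1,±1)} sin(2πk·X)(sin(θ+2π/3), ±sin(θ−2π/3), ±sin θ)
(Brachet's θ-circle; U_0 = U, U_{π/2} = −W_0) is a steady Euler state with force cos(2θ)·f♯ +
sin(2θ)·g♯, where g♯ = −(π/(8√3))Σ sin(2πk·X)g_k over (2,0,±2),(0,2,±2),(2,±2,0) (= 2π·G_TG(2πX));
i.e. Λ winds the circle twice, f♯ ⊥ g♯, ∫|f♯|² = ∫|g♯|² = π²/16. Exact check kit j001650 (all θ,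
symbolic). Provable by finite trigonometric algebra; not load-bearing, documents the competitor
census at one mode (fibre over f♯ in the family = {±U}) and serves the mixed-sector / euler-coercive
cards. [difficulty: provable-now] [doi:10.1017/s0022112083001159, doi:10.1098/rspa.1937.0036,
kit:j001650]
#9 SteadyToSummit (support) — the steady zeroth law (∃ smooth div-free mean-zero f, ν_j → 0⁺, steady
classical states with bounded ∫|u_j|² and ν_j‖∇u_j‖² ≥ ε) implies the summit: steady states are
global Leray–Hopf solutions from their own datum (isGlobalLerayHopf_of_isClassicalNSSolutionOn,
proved), Cesàro means of constants. VERBATIM the support item SteadyToSummit of route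
SteadyWeakLimit (stmt-AnomalousDissipation-1311) — shared, provable now. [difficulty: provable-now]
[stmt-AnomalousDissipation-1311,
Literature.Analysis.FluidPDE.Torus.isGlobalLerayHopf_of_isClassicalNSSolutionOn, DoeringFoias2002]

TWO-LAYER PLAN. NoQuietSteadyTG ⇐ QuietLimitsAreDodgers → DodgerCensusTG → (shadow cruxes) →
NoQuietSteadyTG, k = 3: (a) QuietLimitsAreDodgers — a bounded
mean-zero steady sequence of f♯ with (f♯,u_j) → 0 has a subsequence converging strongly in L² to a
smooth work-free steady Euler state V,
Λ(V) = f♯ (compactness + rigidity; fails exactly in the sheet/bath scenarios); (b) DodgerCensusTG —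
the card's syzygy census K3 made
load-bearing: the smooth mean-zero dodgers of f♯ are classified family by family (TG plane: ±U, ±W
done; next the 8-parameter families
(1,1,1)⊕(1,1,3)⊕… by top-wavenumber peeling and S-lemma certificates, cf. sibling card
mixed-sector-taylor-green-coercive-candidate);
(c) one shadow statement per dodger — cruxes 3, 4 now; their sign twins −U, −W are the ν ↦ −ν mirror
problems (steady NS is not
invariant under u ↦ −u) and become children later. TGVortexNoShadow ⇐ FirstOrderUnsolvable (no
smooth mean-zero w, π with
L_U w + ∇π = ΔU) → NoLayeredShadow → TGVortexNoShadow. BoundedSteadyBranchTG ⇐ SteadyExistsAllNu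
(mean-zero smooth steady states of
NS_ν(f♯) exist for every ν > 0: Leray–Schauder + steady regularity, provable with work) →
UniformL2Selection → BoundedSteadyBranchTG.

KILL CRITERIA. A steady viscous shadow of U or W (¬TGVortexNoShadow or ¬ConjugateVortexNoShadow,
e.g. by a rigorous Newton/continuation or a
Prandtl–Batchelor construction) refutes NoQuietSteadyTG with the same witness: close
`refuted:NoQuietSteadyTG` and hand the witness to
CoherentStates 0221 (first mean-zero bounded steady branch) — no cosmetic restating.
¬BoundedSteadyBranchTG (every mean-zero steady branch
of f♯ has ∫|u_j|² → ∞) kills the steady line in this arena: close `refuted:BoundedSteadyBranchTG`;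
unsteady witnesses for f♯ belong to
CoherentStates/Correlation, not here. SteadyNeg (stmt-0222) proved ⇒ SteadyLoudTG false ⇒ close. A
proof of SteadyZerothLaw 0219 or of the
summit elsewhere moots the route (the arena facts TGDodgers/TGForceRegular stay useful to the
mixed-sector and euler-coercive cards).

NOT DECOMPOSED YET. The rigidity step (quiet limits are dodger shadows) and the dodger census beyond
one mode; the −U/−W mirror shadows; first-order
(un)solvability of L_U w + ∇π = ΔU as a standalone linear statement (child of crux 3 once a grounder
fixes the function class); the
K-symmetric (Taylor–Green reflection class) versions of every item — K is a pending definition of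
other cards and is NOT needed here
(mean-zero replaces it against drift); the unsteady arena statement of the card (K2 with Leray–Hopf
or time-periodic families) and the
sum-free off-spectrum floor / face identity (card P3–P4) — independent deliverables, not
load-bearing for X.

CHEAPEST FALSIFIER. DONE (planner, kit j001623 + j001650, exact Fourier-coefficient algebra): Λ(U) =
f♯ and Λ(W) = f♯ (both differences are gradients), the full
circle identity Λ(U_θ) = cos2θ·f♯ + sin2θ·g♯ for symbolic θ, U = U_TG(2π·) and W = τ_*U_{π/2}
literally, div f♯ = 0, mean zero, (f♯,U) = (f♯,W) = 0, Λ(f♯) ≠ 0 (the Stokes response f♯/(32π²ν) is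
NOT an exact steady state, so no cheap quiet branch) — all
PASS. NEXT (a refuter's day): (i) first-order solvability of L_U w + ∇π = −12π²U by Fourier–Galerkin
least squares on |k|_∞ ≤ N,
N = 8…32, in the symmetry class of U — residual → 0 polynomially is evidence for a shadow (against
cruxes 3 and 2), a residual floor is
evidence for crux 3; (ii) steady Newton continuation in ν of the mean-zero steady branch of NS_ν(f♯)
in the Taylor–Green symmetric
class down to ν ≈ 10⁻³, tracking ∫|u_ν|² and (f♯,u_ν): bounded & work → 0 kills crux 2, unbounded
threatens crux 5, bounded & work ≥ ε
supports X.

NUMBERS. ∫|U|² = ∫|W|² = 1/4, ∫|f♯|² = π²/16, (f♯,U) = (f♯,W) = 0 (kit j001623). Shells: U, W on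
|k|² = 3 (Stokes eigenvalue 12π²,
ν·gradNormSq(U) = 3π²ν → 0 along the exact quiet state of the perturbed force f♯ + 12π²νU); f♯ on
|k|² = 8 (eigenvalue 32π²); laminar
Stokes response u_S = f♯/(32π²ν) with ∫|u_S|² = 1/(16384π²ν²) (unbounded, excluded by the energy
clause). Amplitude is immaterial: the
steady scaling (u,p,ν,f) ↦ (λu, λ²p, λν, λ²f) identifies the statements for f♯ and λ²f♯. Items at
open: 10 (target, 4 cruxes, 4 support,
assembly).

DEFINITION REQUESTS. None: every item is stated over existing declarations
(Torus.IsClassicalNSSolutionOn, Torus.HasZeroMean, Torus.gradNormSq,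
FluidPDE.Torus.stokesMode, Torus.convect, Torus.gradient). The Taylor–Green reflection class K
(requested by card
kelvin-pump-symmetry-skeleton) would allow K-symmetric sharpenings later; not requested again.

Novelty: Searches (2026-08-15): `lit frontier AnomalousDissipation --since 2021` (30 rows: convex integration
/ passive scalars / non-uniqueness; none on steady selection at fixed force); `lit search --source
crossref "stationary Navier-Stokes equations body force inviscid limit steady Euler Taylor-Green"`
(12; doi:10.1007/s11401-023-0011-3 steady 3-D inviscid limit with boundary); `lit search --source
arxiv "Prandtl-Batchelor steady Navier-Stokes vanishing viscosity"` (2: arXiv:2111.03996,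
arXiv:2601.08647 — READ pp.1–2); `lit search --source zbmath "inviscid limit steady Navier-Stokes
Prandtl-Batchelor closed streamlines forcing"` (0); `lit galaxy search "Taylor-Green forcing" --star
all` (6: Ponty et al. PRL 99 (2007) 224501 and dynamo DNS force with the TG MODE U, not with Λ(U);
Shukla–Dubrulle reversible NS); local searchd rc 75 (3 attempts, noted); `ledger negatives --problem
AnomalousDissipation` (3); headers of all 38 Theses of the sub (none uses Lamb fibres / TG arena;
nearest SteadyWeakLimit, CoherentStates, MirrorVariety); plus the card's audited log (refuter -19-0:
doi:10.1098/rspa.1937.0036, doi:10.1017/s0022112083001159, arXiv:math/0210082,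
doi:10.1137/140957354, arXiv:2007.09103, arXiv:2205.01143 Prob. 33).
Nearest prior art found: arXiv:2601.08647 (Gui–Xie–Xu 2026: classification of vanishing-viscosity
limits of STEADY NS among 2-D steady Euler flows — bounded domain: constant vorticity only; strip:
constant/Couette/Poiseuille — unforced, planar); arXiv:2111.03996 (Fei  [refs: 10.1007/s11401-023-0011-3, 10.1098/rspa.1937.0036, 10.1017/s0022112083001159, 10.1137/140957354, 2111.03996, 2601.08647, math/0210082, 2007.09103, 2205.01143, doi:10.1007/s11401-023-0011-3, doi:10.1098/rspa.1937.0036, doi:10.1017/s0022112083001159, doi:10.1137/140957354]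

Barriers (technique_class: steady-branches, lamb-fibres, forced-euler-solvability): - technique_class: steady-branches, lamb-fibres, forced-euler-solvability
- Literature.Barriers.AnomalousDissipation.Cheskidov2023_thm13_not_forceRobustNoAnomaly: blocks
force-robust NO-anomaly proofs; NoQuietSteadyTG is a positive floor and not in the class — but the
same phenomenon bites from the other side and is recorded as this route's own barrier: f♯ + 12π²νU
admits the EXACT quiet bounded steady state U for every ν, so NoQuietSteadyTG and both shadow cruxes
are false for O(ν)-perturbed forces; evasion only by exactness (first-order solvability with the
exact right-hand side ΔU; syzygies of Λ) — conceded that no compactness/energy-method argument can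
prove them.
- Literature.Barriers.AnomalousDissipation.Marchioro1986_globalAttraction: gravest-shell planar
forcing is enslaved/laminar; f♯ is a 3-D pattern on the shell |k|² = 8 whose dodgers are SUBHARMONIC
(|k|² = 3), outside the pincer class; the laminar Stokes branch of f♯ exists but has ∫|u|² =
1/(16384π²ν²) and is excluded by the bounded-energy clause, not by wishful thinking.
- Literature.Barriers.AnomalousDissipation.AlexakisDoering2006_energyDissipationBound: steady 2-D
forcing gives ε ≲ Re^-1/2; U is two-component but x₃-dependent and W three-component, so the arena
is genuinely 3-D; conceded: if the bounded steady branches of f♯ two-dimensionalise, NoQuietSteadyTG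
fails by this bound (in its why-might-fail).
- Literature.Barriers.AnomalousDissipation.DeRosaInversi2024_thm12: BV ∩ L^∞ limits dissipate
nothing — t

sub-problem: AnomalousDissipation · status: done · opened planner-plancard-AnomalousDissipation-Anomalo-94e08340-0 2026-08-15T15:25:04Z · rev 0 · ledger route-AnomalousDissipation-LambCircleTG
GENERATED by the gate from the ledger (D-0016/17). Provers cite these decls: `theorem foo : Summit.AnomalousDissipation.AnomalousDissipation.Theses.LambCircleTG.<Decl> := …` in Summits/AnomalousDissipation/AnomalousDissipation/Theorems/<Name>.lean.
-/

namespace Summit.AnomalousDissipation.AnomalousDissipation.Theses.LambCircleTG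

open scoped BigOperators Topology Manifold Classical MeasureTheory ProbabilityTheory Matrix InnerProductSpace ComplexConjugate ContinuousMap
open Filter Set Function TopologicalSpace MeasureTheory

attribute [summit_statement] _root_.AnomalousDissipation

open Literature.Turb

/-- item stmt-AnomalousDissipation-10196 · target · rank 0 · open · by planner
why it might fail: Every bounded mean-zero steady branch of f♯ may be quiet (shadows of ±U, ±W; Prandtl–Batchelor sheets; Reynolds-stress baths), or none may be bounded (laminar scaling ∫|u|² ∼ ν⁻²); the 2-D analogue is rigid (CTV2013 p.6).
sources: arXiv:1305.7089, arXiv:2311.04182, arXiv:2212.08413, doi:10.1017/s0022112083001159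
[target] steady zeroth law for f♯: ν_j → 0⁺, mean-zero steady classical NS states forced by f♯ with
bounded ∫|u_j|² and ν_j‖∇u_j‖² ≥ ε > 0 (card K2, steady sub-line; = CoherentStates.SteadyZerothLaw
0219 with f := f♯ and mean-zero states). -/
@[route_item "route-AnomalousDissipation-LambCircleTG"]
def SteadyLoudTG : Prop :=
  ∃ (ν : ℕ → ℝ) (u : ℕ → UnitAddTorus (Fin 3) → EuclideanSpace ℝ (Fin 3)) (p : ℕ → UnitAddTorus (Fin 3) → ℝ), (∀ j, 0 < ν j) ∧ Filter.Tendsto ν Filter.atTop (nhds 0) ∧ (∀ j, Literature.Analysis.FunctionSpaces.Torus.IsClassicalNSSolutionOn Set.univ (ν j) (fun _ => (fun x : UnitAddTorus (Fin 3) => (Real.pi / 8 : ℝ) • (Literature.Analysis.FluidPDE.Torus.stokesMode ![2, 0, 2] !₂[1, 0, -1] false x + Literature.Analysis.FluidPDE.Torus.stokesMode ![2, 0, -2] !₂[1, 0, 1] false x + Literature.Analysis.FluidPDE.Torus.stokesMode ![0, 2, 2] !₂[0, 1, -1] false x + Literature.Analysis.FluidPDE.Torus.stokesMode ![0, 2,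 -2] !₂[0, 1, 1] false x))) (fun _ => u j) (fun _ => p j)) ∧ (∀ j, Literature.Analysis.FunctionSpaces.Torus.HasZeroMean (u j)) ∧ (∃ E : ℝ, ∀ j, MeasureTheory.integral MeasureTheory.volume (fun x => ‖u j x‖ ^ 2) ≤ E) ∧ ∃ ε : ℝ, 0 < ε ∧ ∀ j, ε ≤ ν j * Literature.Analysis.FunctionSpaces.Torus.gradNormSq (u j)

/-- item stmt-AnomalousDissipation-10197 · crux · rank 2 · open · by planner
why it might fail: FALSE for the O(ν)-close forces f♯+12π²νU (U is then an exact quiet bounded steady state ∀ν): only an argument exact in f can work. A steady shadow of ±U/±W (regular or √ν-layered), a sheeted PB state or a mean-flow-free Reynolds-stress bath refutes it.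
sources: arXiv:2601.08647, arXiv:2111.03996, doi:10.1137/140957354, Literature.Barriers.AnomalousDissipation.DeRosaInversi2024_thm12, arXiv:1305.7089, arXiv:2212.08413
[crux] every sequence of MEAN-ZERO steady classical NS states forced by f♯ with ν_j → 0⁺ and sup_j
∫|u_j|² < ∞ has inf_j ν_j‖∇u_j‖² > 0 (each term is positive and equals (f♯,u_j), so this is liminf
(f♯,u_j) > 0: no bounded steady branch of f♯ becomes work-free). Card K1/K3 made load-bearing: its
quiet endpoints would be dodgers Λ(V) = f♯ (±U, ±W at one mode) or their singular relatives.
[difficulty: XL] -/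
@[route_item "route-AnomalousDissipation-LambCircleTG", crux]
def NoQuietSteadyTG : Prop :=
  ∀ (ν : ℕ → ℝ) (u : ℕ → UnitAddTorus (Fin 3) → EuclideanSpace ℝ (Fin 3)) (p : ℕ → UnitAddTorus (Fin 3) → ℝ), (∀ j, 0 < ν j) → Filter.Tendsto ν Filter.atTop (nhds 0) → (∀ j, Literature.Analysis.FunctionSpaces.Torus.IsClassicalNSSolutionOn Set.univ (ν j) (fun _ => (fun x : UnitAddTorus (Fin 3) => (Real.pi / 8 : ℝ) • (Literature.Analysis.FluidPDE.Torus.stokesMode ![2, 0, 2] !₂[1, 0, -1] false x + Literature.Analysis.FluidPDE.Torus.stokesMode ![2, 0, -2] !₂[1, 0, 1] false x + Literature.Analysis.FluidPDE.Torus.stokesMode ![0, 2, 2] !₂[0, 1, -1] false x + Literature.Analysis.FluidPDE.Torus.stokesMode ![0, 2, -2] !₂[0, 1, 1] false x))) (fun _ => u j) (fun _ => p j)) → (∀ j, Literature.Analysis.FunctionSpaces.Torus.HasZeroMean (u j)) → (∃ E : ℝ, ∀ j, MeasureTheory.integral MeasureTheory.volume (fun x => ‖u j x‖ ^ 2) ≤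 E) → ∃ ε : ℝ, 0 < ε ∧ ∀ j, ε ≤ ν j * Literature.Analysis.FunctionSpaces.Torus.gradNormSq (u j)

/-- item stmt-AnomalousDissipation-10198 · crux · rank 3 · open · by planner
why it might fail: First-order solvability of L_U w + ∇π = ΔU on the planar TG cells is undecided; cellular flows relax on the enhanced O(ν^-1/2) scale, so a Newton step of size O(√ν) may close, or √ν layers along the cell separatrices may build a layered shadow as on the disk (Fei–Gao–Lin–Tao).
sources: arXiv:2111.03996, arXiv:2601.08647, doi:10.1017/s0022112083001159, KhesinKuksinPeraltaSalas2014 (Adv. Math. 267, 498–522), doi:10.1007/s11401-023-0011-3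
[crux] no sequence of mean-zero steady classical NS states forced by f♯ with ν_j → 0⁺ converges in
L² to the Taylor–Green vortex U = ¼Σ_{k∈(1,±1,±1)} sin(2πk·X)b_k (the dodger Λ(U) = f♯ has no steady
viscous shadow). Special case of NoQuietSteadyTG: such a sequence is bounded and (f♯,u_j) → (f♯,U) =
0. Card K1 (θ = 0, planar closed cells). [deps: NoQuietSteadyTG] [difficulty: L] -/
@[route_item "route-AnomalousDissipation-LambCircleTG"]
def TGVortexNoShadow : Prop :=
  ∀ (ν : ℕ → ℝ) (u : ℕ → UnitAddTorus (Fin 3) → EuclideanSpace ℝ (Fin 3)) (p : ℕ → UnitAddTorus (Fin 3) → ℝ), (∀ j, 0 < ν j) → Filter.Tendsto ν Filter.atTop (nhds 0) → (∀ j, Literature.Analysis.FunctionSpaces.Torus.IsClassicalNSSolutionOn Set.univ (ν j) (fun _ => (fun x : UnitAddTorus (Fin 3) => (Real.pi / 8 : ℝ) • (Literature.Analysis.FluidPDE.Torus.stokesMode ![2, 0, 2] !₂[1, 0, -1] false x + Literature.Analysis.FluidPDE.Torus.stokesMode ![2, 0, -2] !₂[1, 0, 1] false x + Literature.Analysis.FluidPDE.Torus.stokesMode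 ![0, 2, 2] !₂[0, 1, -1] false x + Literature.Analysis.FluidPDE.Torus.stokesMode ![0, 2, -2] !₂[0, 1, 1] false x))) (fun _ => u j) (fun _ => p j)) → (∀ j, Literature.Analysis.FunctionSpaces.Torus.HasZeroMean (u j)) → ¬ Filter.Tendsto (fun j => MeasureTheory.integral MeasureTheory.volume (fun x => ‖u j x - (fun x : UnitAddTorus (Fin 3) => (1 / 4 : ℝ) • (Literature.Analysis.FluidPDE.Torus.stokesMode ![1, 1, 1] !₂[1, -1, 0] false x + Literature.Analysis.FluidPDE.Torus.stokesMode ![1, 1, -1] !₂[1, -1, 0] false x + Literature.Analysis.FluidPDE.Torus.stokesMode ![1, -1, 1] !₂[1, 1, 0] false x + Literature.Analysis.FluidPDE.Torus.stokesMode ![1, -1, -1] !₂[1, 1, 0] false x)) x‖ ^ 2)) Filter.atTop (nhds 0)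

/-- item stmt-AnomalousDissipation-10199 · crux · rank 4 · open · by planner
why it might fail: W is genuinely three-component with non-integrable streamline geometry: no Newcomb/streamline reduction of the linearised steady operator, so neither obstruction nor construction is cheap; a KAM-type or layered steady continuation (CDG-style flexibility) would refute it.
sources: doi:10.1017/s0022112083001159, arXiv:2007.09103, arXiv:2205.01143, arXiv:2601.08647
[crux] no sequence of mean-zero steady classical NS states forced by f♯ with ν_j → 0⁺ converges in
L² to the conjugate vortex W = τ_*U_{π/2} = (1/(4√3))Σ_{k∈(1,±1,±1)} sin(2πk·X)w_k (three-component;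
Λ(W) = f♯ because Λ(U_{π/2}) = −F_TG and τ_*F_TG = −F_TG, τ = (¼,¼,0)). Special case of
NoQuietSteadyTG. Card K1 (θ = π/2). [deps: NoQuietSteadyTG] [difficulty: L] -/
@[route_item "route-AnomalousDissipation-LambCircleTG"]
def ConjugateVortexNoShadow : Prop :=
  ∀ (ν : ℕ → ℝ) (u : ℕ → UnitAddTorus (Fin 3) → EuclideanSpace ℝ (Fin 3)) (p : ℕ → UnitAddTorus (Fin 3) → ℝ), (∀ j, 0 < ν j) → Filter.Tendsto ν Filter.atTop (nhds 0) → (∀ j, Literature.Analysis.FunctionSpaces.Torus.IsClassicalNSSolutionOn Set.univ (ν j) (fun _ => (fun x : UnitAddTorus (Fin 3) => (Real.pi / 8 : ℝ) • (Literature.Analysis.FluidPDE.Torus.stokesMode ![2, 0, 2] !₂[1, 0, -1] false x + Literature.Analysis.FluidPDE.Torus.stokesMode ![2, 0, -2] !₂[1, 0, 1] false x + Literature.Analysis.FluidPDE.Torus.stokesMode ![0, 2, 2] !₂[0, 1, -1] false x + Literature.Analysis.FluidPDE.Torus.stokesMode ![0, 2, -2] !₂[0, 1, 1] false x))) (fun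 _ => u j) (fun _ => p j)) → (∀ j, Literature.Analysis.FunctionSpaces.Torus.HasZeroMean (u j)) → ¬ Filter.Tendsto (fun j => MeasureTheory.integral MeasureTheory.volume (fun x => ‖u j x - (fun x : UnitAddTorus (Fin 3) => (1 / (4 * Real.sqrt 3) : ℝ) • (Literature.Analysis.FluidPDE.Torus.stokesMode ![1, 1, 1] !₂[-1, -1, 2] false x + Literature.Analysis.FluidPDE.Torus.stokesMode ![1, 1, -1] !₂[-1, -1, -2] false x + Literature.Analysis.FluidPDE.Torus.stokesMode ![1, -1, 1] !₂[1, -1, -2] false x + Literature.Analysis.FluidPDE.Torus.stokesMode ![1, -1, -1] !₂[1, -1, 2] false x)) x‖ ^ 2)) Filter.atTop (nhds 0)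

/-- item stmt-AnomalousDissipation-10200 · crux · rank 5 · open · by planner
why it might fail: Only the laminar bound ‖∇u‖ ≤ ‖f‖/ν is known; every steady branch of f♯ may inherit the Stokes scaling ∫|u|² ∼ ν⁻² (existence of bounded stationary sequences is open even for Kolmogorov forcing, CTV2013 p.3); if ±U, ±W have shadows it holds but crux 2 dies.
sources: arXiv:1305.7089, Temam1979, FoiasManleyRosaTemam2001, doi:10.1088/0951-7715/28/9/3219
[crux] there are ν_j → 0⁺ and mean-zero steady classical NS states (u_j,p_j) forced by f♯ with sup_j
∫|u_j|² < ∞ (a bounded steady branch of the TG pattern force; mean-zero steady states exist for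
every ν by Leray–Schauder, the content is the ν-uniform L² bound). [difficulty: XL] -/
@[route_item "route-AnomalousDissipation-LambCircleTG", crux]
def BoundedSteadyBranchTG : Prop :=
  ∃ (ν : ℕ → ℝ) (u : ℕ → UnitAddTorus (Fin 3) → EuclideanSpace ℝ (Fin 3)) (p : ℕ → UnitAddTorus (Fin 3) → ℝ), (∀ j, 0 < ν j) ∧ Filter.Tendsto ν Filter.atTop (nhds 0) ∧ (∀ j, Literature.Analysis.FunctionSpaces.Torus.IsClassicalNSSolutionOn Set.univ (ν j) (fun _ => (fun x : UnitAddTorus (Fin 3) => (Real.pi / 8 : ℝ) • (Literature.Analysis.FluidPDE.Torus.stokesMode ![2, 0, 2] !₂[1, 0, -1] false x + Literature.Analysis.FluidPDE.Torus.stokesMode ![2, 0, -2] !₂[1, 0, 1] false x + Literature.Analysis.FluidPDE.Torus.stokesMode ![0, 2, 2] !₂[0, 1, -1] false x + Literature.Analysis.FluidPDE.Torus.stokesMode ![0, 2, -2] !₂[0, 1, 1] false x))) (fun _ => u j) (fun _ => p j)) ∧ (∀ j, Literature.Analysis.FunctionSpaces.Torus.HasZeroMean (u j)) ∧ ∃ E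 : ℝ, ∀ j, MeasureTheory.integral MeasureTheory.volume (fun x => ‖u j x‖ ^ 2) ≤ E

/-- item stmt-AnomalousDissipation-10201 · support · rank 9 · open · by planner
sources: Literature.Analysis.FluidPDE.Torus.isSmooth_stokesMode, Literature.Analysis.FluidPDE.Torus.isDivFree_stokesMode, Literature.Analysis.FluidPDE.Torus.hasZeroMean_stokesMode
[support] f♯ is smooth, divergence-free and mean-zero (sum of four Stokes modes sin(2πk·X)a_k with k
≠ 0 and k·a_k = 0: isSmooth_stokesMode, isDivFree_stokesMode, hasZeroMean_stokesMode + linearity).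
[difficulty: provable-now] -/
@[route_item "route-AnomalousDissipation-LambCircleTG", crux]
def TGForceRegular : Prop :=
  Literature.Analysis.FunctionSpaces.Torus.IsSmooth (fun x : UnitAddTorus (Fin 3) => (Real.pi / 8 : ℝ) • (Literature.Analysis.FluidPDE.Torus.stokesMode ![2, 0, 2] !₂[1, 0, -1] false x + Literature.Analysis.FluidPDE.Torus.stokesMode ![2, 0, -2] !₂[1, 0, 1] false x + Literature.Analysis.FluidPDE.Torus.stokesMode ![0, 2, 2] !₂[0, 1, -1] false x + Literature.Analysis.FluidPDE.Torus.stokesMode ![0, 2, -2] !₂[0, 1, 1] false x)) ∧ Literature.Analysis.FunctionSpaces.Torus.IsDivFree (fun x : UnitAddTorus (Fin 3) => (Real.pi / 8 : ℝ) • (Literature.Analysis.FluidPDE.Torus.stokesMode ![2, 0, 2] !₂[1, 0, -1] false x + Literature.Analysis.FluidPDE.Torus.stokesMode ![2, 0, -2] !₂[1, 0, 1] false x + Literature.Analysis.FluidPDE.Torus.stokesMode ![0, 2, 2] !₂[0, 1, -1] false x + Literature.Analysis.FluidPDE.Torus.stokesMode ![0, 2, -2] !₂[0, 1, 1] false x))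 ∧ Literature.Analysis.FunctionSpaces.Torus.HasZeroMean (fun x : UnitAddTorus (Fin 3) => (Real.pi / 8 : ℝ) • (Literature.Analysis.FluidPDE.Torus.stokesMode ![2, 0, 2] !₂[1, 0, -1] false x + Literature.Analysis.FluidPDE.Torus.stokesMode ![2, 0, -2] !₂[1, 0, 1] false x + Literature.Analysis.FluidPDE.Torus.stokesMode ![0, 2, 2] !₂[0, 1, -1] false x + Literature.Analysis.FluidPDE.Torus.stokesMode ![0, 2, -2] !₂[0, 1, 1] false x))

/-- item stmt-AnomalousDissipation-10202 · support · rank 9 · open · by planner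
sources: doi:10.1098/rspa.1937.0036, doi:10.1017/s0022112083001159, kit:j001623
[support] the Taylor–Green vortex U and the conjugate vortex W are exact work-free steady Euler
states under f♯: (U·∇)U + ∇P = f♯ and (W·∇)W + ∇P′ = f♯ for smooth (trigonometric) pressures (card
P1 at θ = 0 and, via τ, θ = π/2; exact Fourier-coefficient checks kit j001623 and j001650: both
differences are gradients, (f♯,U) = (f♯,W) = 0, ∫|U|² = ∫|W|² = ¼, ∫|f♯|² = π²/16). Provable by
finite trigonometric algebra on products of Stokes modes. [difficulty: provable-now] -/
@[route_item "route-AnomalousDissipation-LambCircleTG"]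
def TGDodgers : Prop :=
  (∃ P : UnitAddTorus (Fin 3) → ℝ, Literature.Analysis.FunctionSpaces.Torus.IsSmooth P ∧ ∀ x, Literature.Analysis.FunctionSpaces.Torus.convect (fun x : UnitAddTorus (Fin 3) => (1 / 4 : ℝ) • (Literature.Analysis.FluidPDE.Torus.stokesMode ![1, 1, 1] !₂[1, -1, 0] false x + Literature.Analysis.FluidPDE.Torus.stokesMode ![1, 1, -1] !₂[1, -1, 0] false x + Literature.Analysis.FluidPDE.Torus.stokesMode ![1, -1, 1] !₂[1, 1, 0] false x + Literature.Analysis.FluidPDE.Torus.stokesMode ![1, -1, -1] !₂[1, 1, 0] false x)) (fun x : UnitAddTorus (Fin 3) => (1 / 4 : ℝ) • (Literature.Analysis.FluidPDE.Torus.stokesMode ![1, 1, 1] !₂[1, -1, 0] false x + Literature.Analysis.FluidPDE.Torus.stokesMode ![1, 1, -1] !₂[1, -1, 0] false x + Literature.Analysis.FluidPDE.Torus.stokesMode ![1, -1, 1] !₂[1, 1, 0] false x + Literature.Analysis.FluidPDE.Torus.stokesMode ![1, -1, -1] !₂[1, 1, 0] false x)) x + Literature.Analysis.FunctionSpaces.Torus.gradient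 P x = (fun x : UnitAddTorus (Fin 3) => (Real.pi / 8 : ℝ) • (Literature.Analysis.FluidPDE.Torus.stokesMode ![2, 0, 2] !₂[1, 0, -1] false x + Literature.Analysis.FluidPDE.Torus.stokesMode ![2, 0, -2] !₂[1, 0, 1] false x + Literature.Analysis.FluidPDE.Torus.stokesMode ![0, 2, 2] !₂[0, 1, -1] false x + Literature.Analysis.FluidPDE.Torus.stokesMode ![0, 2, -2] !₂[0, 1, 1] false x)) x) ∧ (∃ P : UnitAddTorus (Fin 3) → ℝ, Literature.Analysis.FunctionSpaces.Torus.IsSmooth P ∧ ∀ x, Literature.Analysis.FunctionSpaces.Torus.convect (fun x : UnitAddTorus (Fin 3) => (1 / (4 * Real.sqrt 3) : ℝ) • (Literature.Analysis.FluidPDE.Torus.stokesMode ![1, 1, 1] !₂[-1, -1, 2] false x + Literature.Analysis.FluidPDE.Torus.stokesMode ![1, 1, -1] !₂[-1, -1, -2] false x + Literature.Analysis.FluidPDE.Torus.stokesMode ![1, -1, 1] !₂[1, -1, -2] false x + Literature.Analysis.FluidPDE.Torus.stokesMode ![1, -1, -1] !₂[1, -1, 2] false x)) (fun x : UnitAddTorus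 (Fin 3) => (1 / (4 * Real.sqrt 3) : ℝ) • (Literature.Analysis.FluidPDE.Torus.stokesMode ![1, 1, 1] !₂[-1, -1, 2] false x + Literature.Analysis.FluidPDE.Torus.stokesMode ![1, 1, -1] !₂[-1, -1, -2] false x + Literature.Analysis.FluidPDE.Torus.stokesMode ![1, -1, 1] !₂[1, -1, -2] false x + Literature.Analysis.FluidPDE.Torus.stokesMode ![1, -1, -1] !₂[1, -1, 2] false x)) x + Literature.Analysis.FunctionSpaces.Torus.gradient P x = (fun x : UnitAddTorus (Fin 3) => (Real.pi / 8 : ℝ) • (Literature.Analysis.FluidPDE.Torus.stokesMode ![2, 0, 2] !₂[1, 0, -1] false x + Literature.Analysis.FluidPDE.Torus.stokesMode ![2, 0, -2] !₂[1, 0, 1] false x + Literature.Analysis.FluidPDE.Torus.stokesMode ![0, 2, 2] !₂[0, 1, -1] false x + Literature.Analysis.FluidPDE.Torus.stokesMode ![0, 2, -2] !₂[0, 1, 1] false x)) x)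

/-- item stmt-AnomalousDissipation-10203 · support · rank 9 · open · by planner
sources: doi:10.1017/s0022112083001159, doi:10.1098/rspa.1937.0036, kit:j001650
[support] the card's Lamb-circle identity in unit-torus form: for every θ the Taylor–Green field U_θ
= (1/(2√3))Σ_{k∈(1,±1,±1)} sin(2πk·X)(sin(θ+2π/3), ±sin(θ−2π/3), ±sin θ) (Brachet's θ-circle; U_0 =
U, U_{π/2} = −W_0) is a steady Euler state with force cos(2θ)·f♯ + sin(2θ)·g♯, where g♯ =
−(π/(8√3))Σ sin(2πk·X)g_k over (2,0,±2),(0,2,±2),(2,±2,0) (= 2π·G_TG(2πX)); i.e. Λ winds the circle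
twice, f♯ ⊥ g♯, ∫|f♯|² = ∫|g♯|² = π²/16. Exact check kit j001650 (all θ, symbolic). Provable by
finite trigonometric algebra; not load-bearing, documents the competitor census at one mode (fibre
over f♯ in the family = {±U}) and serves the mixed-sector / euler-coercive cards. [difficulty:
provable-now] -/
@[route_item "route-AnomalousDissipation-LambCircleTG"]
def TGLambCircle : Prop :=
  ∀ θ : ℝ, ∃ P : UnitAddTorus (Fin 3) → ℝ, Literature.Analysis.FunctionSpaces.Torus.IsSmooth P ∧ ∀ x, Literature.Analysis.FunctionSpaces.Torus.convect (fun x : UnitAddTorus (Fin 3) => (1 / (2 * Real.sqrt 3) : ℝ) • (Literature.Analysis.FluidPDE.Torus.stokesMode ![1, 1, 1] !₂[Real.sin (θ + 2 * Real.pi / 3), Real.sin (θ - 2 * Real.pi / 3), Real.sin θ] false x + Literature.Analysis.FluidPDE.Torus.stokesMode ![1, 1, -1] !₂[Real.sin (θ + 2 * Real.pi / 3), Real.sin (θ - 2 * Real.pi / 3), -Real.sin θ] false x + Literature.Analysis.FluidPDE.Torus.stokesMode ![1, -1, 1] !₂[Real.sin (θ + 2 * Real.pi / 3), -Real.sin (θ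 - 2 * Real.pi / 3), Real.sin θ] false x + Literature.Analysis.FluidPDE.Torus.stokesMode ![1, -1, -1] !₂[Real.sin (θ + 2 * Real.pi / 3), -Real.sin (θ - 2 * Real.pi / 3), -Real.sin θ] false x)) (fun x : UnitAddTorus (Fin 3) => (1 / (2 * Real.sqrt 3) : ℝ) • (Literature.Analysis.FluidPDE.Torus.stokesMode ![1, 1, 1] !₂[Real.sin (θ + 2 * Real.pi / 3), Real.sin (θ - 2 * Real.pi / 3), Real.sin θ] false x + Literature.Analysis.FluidPDE.Torus.stokesMode ![1, 1, -1] !₂[Real.sin (θ + 2 * Real.pi / 3), Real.sin (θ - 2 * Real.pi / 3), -Real.sin θ] false x + Literature.Analysis.FluidPDE.Torus.stokesMode ![1, -1, 1] !₂[Real.sin (θ + 2 * Real.pi / 3), -Real.sin (θ - 2 * Real.pi / 3), Real.sin θ] false x + Literature.Analysis.FluidPDE.Torus.stokesMode ![1, -1, -1] !₂[Real.sin (θ + 2 * Real.pi / 3), -Real.sin (θ - 2 * Real.pi / 3), -Real.sin θ] false x)) x + Literature.Analysis.FunctionSpaces.Torus.gradient P x = Real.cos (2 * θ) • (fun x : UnitAddTorus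 (Fin 3) => (Real.pi / 8 : ℝ) • (Literature.Analysis.FluidPDE.Torus.stokesMode ![2, 0, 2] !₂[1, 0, -1] false x + Literature.Analysis.FluidPDE.Torus.stokesMode ![2, 0, -2] !₂[1, 0, 1] false x + Literature.Analysis.FluidPDE.Torus.stokesMode ![0, 2, 2] !₂[0, 1, -1] false x + Literature.Analysis.FluidPDE.Torus.stokesMode ![0, 2, -2] !₂[0, 1, 1] false x)) x + Real.sin (2 * θ) • (fun x : UnitAddTorus (Fin 3) => (-(Real.pi / (8 * Real.sqrt 3)) : ℝ) • (Literature.Analysis.FluidPDE.Torus.stokesMode ![2, 0, 2] !₂[1, 0, -1] false x + Literature.Analysis.FluidPDE.Torus.stokesMode ![2, 0, -2] !₂[1, 0, 1] false x + Literature.Analysis.FluidPDE.Torus.stokesMode ![0, 2, 2] !₂[0, -1, 1] false x + Literature.Analysis.FluidPDE.Torus.stokesMode ![0, 2, -2] !₂[0, -1, -1] false x + Literature.Analysis.FluidPDE.Torus.stokesMode ![2, 2, 0] !₂[2, -2, 0] false x + Literature.Analysis.FluidPDE.Torus.stokesMode ![2, -2, 0] !₂[2, 2, 0] false x)) x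

/-- item stmt-AnomalousDissipation-1311 · support · rank 9 · closed · proved by Summit.AnomalousDissipation.AnomalousDissipation.Theorems.steadyToSummit_proof @ 58e56dd0c7bd (prover) · by planner
sources: stmt-AnomalousDissipation-1311, Literature.Analysis.FluidPDE.Torus.isGlobalLerayHopf_of_isClassicalNSSolutionOn, DoeringFoias2002
[support] Provable now (~120 lines); antecedent = SteadyZerothLaw (stmt-AnomalousDissipation-0219)
verbatim. Steady classical states are 1-periodic classical solutions on ℝ × T³ (u j, p j constant in
time; Function.Periodic (fun _ => u j) 1 trivially); meanEnergy (fun _ => u j) = ∫‖u j x‖² and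
meanDissipation (ν j) (fun _ => u j) = ν j * gradNormSq (u j) because timeMean of a constant c is c
for T ≠ 0 (intervalIntegral.integral_const, so longTimeAvgSup = c; or
Literature.Turb.tendsto_timeMean_of_periodic, proved in Theorems/EulerLimitCesaro.lean) and
gradNormSq = (eGradNormSq ·).toReal on smooth slices (Torus.gradNormSq_eq_toReal_eGradNormSq_holds;
slice smoothness IsSmoothSpaceTimeOn.isSmooth_slice); conclude with
AnomalousDissipation.CoherentStates.coherent_assembly_fact applied to
Torus.isGlobalLerayHopf_of_isClassicalNSSolutionOn_holds (Theorems/CoherentStatesAssembly.lean,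
Literature/Analysis/FluidPDE/TorusClassicalLerayHopfProofs.lean — both PROVED). Records the ledger
edge 0219 ⇒ summit, usable by CoherentStates as well. -/
@[route_item "route-AnomalousDissipation-LambCircleTG", crux]
def SteadyToSummit : Prop :=
  (∃ f : UnitAddTorus (Fin 3) → EuclideanSpace ℝ (Fin 3), Literature.Analysis.FunctionSpaces.Torus.IsSmooth f ∧ Literature.Analysis.FunctionSpaces.Torus.IsDivFree f ∧ Literature.Analysis.FunctionSpaces.Torus.HasZeroMean f ∧ ∃ (ν : ℕ → ℝ) (u : ℕ → UnitAddTorus (Fin 3) → EuclideanSpace ℝ (Fin 3)) (p : ℕ → UnitAddTorus (Fin 3) → ℝ), (∀ j, 0 < ν j) ∧ Filter.Tendsto ν Filter.atTop (nhds 0) ∧ (∀ j, Literature.Analysis.FunctionSpaces.Torus.IsClassicalNSSolutionOn Set.univ (ν j) (fun _ => f) (fun _ => u j) (fun _ => p j)) ∧ (∃ E : ℝ, ∀ j, MeasureTheory.integral MeasureTheory.volume (fun x => ‖u j x‖ ^ 2) ≤ E) ∧ ∃ ε : ℝ, 0 < ε ∧ ∀ j, ε ≤ ν j * Literature.Analysis.FunctionSpaces.Torus.gradNormSq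 (u j)) → AnomalousDissipation

/-- item stmt-AnomalousDissipation-10204 · assembly · rank 1 · open · by planner
sources: DoeringFoias2002, stmt-AnomalousDissipation-1311
[assembly] TGForceRegular → BoundedSteadyBranchTG → NoQuietSteadyTG → SteadyToSummit →
AnomalousDissipation. -/
@[route_item "route-AnomalousDissipation-LambCircleTG"]
def Assembly : Prop :=
  TGForceRegular → BoundedSteadyBranchTG → NoQuietSteadyTG → SteadyToSummit → AnomalousDissipation

/-! D-0027 §2.1 — DECIDING THEOREM (planner-authored via `route open/edit --closes-file`; by planner-plancard-AnomalousDissipation-Anomalo-94e08340-0 2026-08-15T15:25:05Z):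
its hypotheses are this route's items and its conclusion the sub-problem Statement (glue_lint), and it elaborates with this file. -/

@[closes "route-AnomalousDissipation-LambCircleTG"] theorem closes : TGForceRegular → BoundedSteadyBranchTG → NoQuietSteadyTG → SteadyToSummit → _root_.AnomalousDissipation := by
  intro hF hB hN hS
  obtain ⟨ν, u, p, hν, hν0, hsol, hmean, E, hE⟩ := hB
  obtain ⟨ε, hε, hfl⟩ := hN ν u p hν hν0 hsol hmean ⟨E, hE⟩
  exact hS ⟨_, hF.1, hF.2.1, hF.2.2, ν, u, p, hν, hν0, hsol, ⟨E, hE⟩, ε, hε, hfl⟩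

end Summit.AnomalousDissipation.AnomalousDissipation.Theses.LambCircleTG
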